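import Literature.Topology.FourManifolds.HandleBackwardFlow
import Literature.Topology.FourManifolds.RelatedFlows
import HarnessLib

/-!
# The chart map between two handle charts: coordinates, levels, smoothness, and the flows

Topic `Literature/Topology/FourManifolds` (fact seat
`provefact-Literature.Topology.FourManifolds.IsHandlebody.exists_isBoundaryGluing_sphere`, step F2b of
the Lickorish–Wallace DAG; comparison layer of the handle-extension step of the classification
of handlebodies).  Everything here is **proved**; no named facts.

Two handle charts `D` (about `p` in `M`, for `f, X`) and `D'` (about `p'` in `M'`, for
`f', X'`) of the same index and core radius carry the same model in coordinates
(`HandleChartField.lean`: `f = f p + Q_k(u)`, `dφ̂ X = Ê_{k,r}(u)`).  The **chart map**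
`D.chartMap D' = φ̂'⁻¹ ∘ (φ̂' p' + ·) ∘ (φ̂ - φ̂ p)` ("identify the two coordinate systems",
Milnor 1965, proof of Thm. 3.13: the cell `H` is described in the coordinates of Def. 3.1)
therefore:

* preserves the coordinates (`coord_chartMap`), shifts the levels by `f' p' - f p`
  (`apply_chartMap`), is involutive with the chart map the other way (`chartMap_chartMap`), and
  carries handle regions and cores to handle regions and cores (`mem_region_chartMap_iff`);
* is smooth on the open chart ball (`contMDiffOn_chartMap`), the closed ball of radius `R`
  about the centres lying in both chart targets;
* **intertwines the fields**, `d(chartMap)(X) = X' ∘ chartMap` on the chart ball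
  (`mfderiv_chartMap_apply`), hence **conjugates the flows** as long as an orbit stays in the
  chart ball (`IsFlowOf.chartMap_apply_eq`, by `RelatedFlows.lean`).

## References

* J. Milnor, *Lectures on the h-cobordism theorem* (1965), Def. 3.1 and proofs of Thms. 3.12,
  3.13 (PDF pp. 12, 17–19). [MilnorHCobordism1965]
* J. M. Lee, *Introduction to Smooth Manifolds*, 2nd ed. (2012), Prop. 9.13. [LeeSmoothManifolds2013]
-/

open scoped Manifold ContDiff Topology
open Set Function Filter Metric

noncomputable section

namespace Literature.Topology.FourManifolds

universe u

variable {m : ℕ} {H : Type*} [TopologicalSpace H] {J : ModelWithCorners ℝ (EuclideanSpace ℝ (Fin m)) H}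
  {M : Type u} [TopologicalSpace M] [ChartedSpace H M]
  {M' : Type u} [TopologicalSpace M'] [ChartedSpace H M']

/-- Local notation: `𝔼 m` is the model Euclidean space `EuclideanSpace ℝ (Fin m)`. -/
local notation "𝔼 " m:arg => EuclideanSpace ℝ (Fin m)

/-- The normalised model field depends on `k` and `r` only (not on the proof of `0 < r`).
[folklore] -/
theorem handleModelField_congr {k k' : ℕ} {r r' : ℝ} (hr : 0 < r) (hr' : 0 < r') (hk : k = k')
    (hrr : r = r') (u : 𝔼 m) : handleModelField k hr u = handleModelField k' hr' u := by
  subst hk; subst hrr; rfl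

namespace HandleChart

variable {f : M → ℝ} {X : Π x : M, TangentSpace J x} {p : M}
  {f' : M' → ℝ} {X' : Π x : M', TangentSpace J x} {p' : M'}
  (D : HandleChart J f X p) (D' : HandleChart J f' X' p')

/-! ### The chart ball -/

/-- **The open chart ball** `{q ∈ φ.source | ‖u‖ < R}`. [folklore] -/
def cball (R : ℝ) : Set M := {q | q ∈ D.chart.source ∧ ‖D.coord q‖ < R}

variable {R : ℝ}

/-- The chart ball is open. [folklore] -/
theorem isOpen_cball : IsOpen (D.cball R) := by
  have h := D.continuousOn_coord.isOpen_inter_preimage D.chart.open_source (isOpen_ball (x := (0 : 𝔼 m)) (ε := R))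
  convert h using 1
  ext q
  simp [cball]

/-- Points of the closed chart ball, read in the target. [folklore] -/
theorem extend_mem_target_of_norm_le (hR : closedBall (D.chart.extend J p) R ⊆ (D.chart.extend J).target)
    {v : 𝔼 m} (hv : ‖v‖ ≤ R) : D.chart.extend J p + v ∈ (D.chart.extend J).target :=
  hR (by rw [mem_closedBall, dist_eq_norm, add_sub_cancel_left]; exact hv)

/-- The preimage of a small vector lies in the source, with that coordinate. [folklore] -/
theorem symm_add_mem_source (hR : closedBall (D.chart.extend J p) R ⊆ (D.chart.extend J).target)
    {v : 𝔼 m} (hv : ‖v‖ ≤ R) :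
    (D.chart.extend J).symm (D.chart.extend J p + v) ∈ D.chart.source ∧
      D.coord ((D.chart.extend J).symm (D.chart.extend J p + v)) = v := by
  have ht := D.extend_mem_target_of_norm_le hR hv
  refine ⟨by rw [← D.chart.extend_source (I := J)]; exact (D.chart.extend J).map_target ht, ?_⟩
  rw [coord, (D.chart.extend J).right_inv ht, add_sub_cancel_left]

/-! ### The chart map -/

/-- **The chart map** `φ̂'⁻¹ ∘ (φ̂' p' + ·) ∘ (φ̂ - φ̂ p)` from the chart of `D` to the chart of
`D'` (the identification of the two Milnor coordinate systems). [cite: MilnorHCobordism1965, Def. 3.1 and proof of Thm. 3.13] -/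
def chartMap (x : M) : M' := (D'.chart.extend J).symm (D'.chart.extend J p' + D.coord x)

variable (hR' : closedBall (D'.chart.extend J p') R ⊆ (D'.chart.extend J).target)
include hR'

/-- The chart map lands in the source of `D'`, with the same coordinates. [folklore] -/
theorem chartMap_mem_source_and_coord {x : M} (hx : ‖D.coord x‖ ≤ R) :
    D.chartMap D' x ∈ D'.chart.source ∧ D'.coord (D.chartMap D' x) = D.coord x :=
  D'.symm_add_mem_source hR' hx

/-- **The chart map preserves the coordinates.** [folklore] -/
theorem coord_chartMap {x : M} (hx : ‖D.coord x‖ ≤ R) : D'.coord (D.chartMap D' x) = D.coord x :=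
  (D.chartMap_mem_source_and_coord D' hR' hx).2

/-- The chart map sends the chart ball into the chart ball. [folklore] -/
theorem chartMap_mem_cball {x : M} (hx : x ∈ D.cball R) : D.chartMap D' x ∈ D'.cball R := by
  obtain ⟨hs, hc⟩ := D.chartMap_mem_source_and_coord D' hR' hx.2.le
  exact ⟨hs, by rw [hc]; exact hx.2⟩

/-- **The chart map shifts the levels by `f' p' - f p`** (same normal form, same index).
[cite: MilnorHCobordism1965, Def. 3.1] -/
theorem apply_chartMap (hk : D.k = D'.k) {x : M} (hxs : x ∈ D.chart.source) (hx : ‖D.coord x‖ ≤ R) :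
    f' (D.chartMap D' x) = f x + (f' p' - f p) := by
  obtain ⟨hs, hc⟩ := D.chartMap_mem_source_and_coord D' hR' hx
  have h1 := D'.apply_eq _ hs
  have h2 := D.apply_eq x hxs
  change f' (D.chartMap D' x) = f' p' + milnorQuadratic D'.k (D'.coord (D.chartMap D' x)) at h1
  change f x = f p + milnorQuadratic D.k (D.coord x) at h2
  rw [h1, hc, ← hk, h2]; ring

omit hR' in
/-- **The two chart maps are inverse to each other** on the chart balls. [folklore] -/
theorem chartMap_chartMap (hR' : closedBall (D'.chart.extend J p') R ⊆ (D'.chart.extend J).target)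
    {x : M} (hxs : x ∈ D.chart.source) (hx : ‖D.coord x‖ ≤ R) :
    D'.chartMap D (D.chartMap D' x) = x := by
  rw [chartMap, D.coord_chartMap D' hR' hx, coord, add_sub_cancel,
    (D.chart.extend J).left_inv (by rw [D.chart.extend_source]; exact hxs)]

/-- **The chart map carries handle regions to handle regions** (levels shifted by
`σ = f' p' - f p`). [cite: MilnorHCobordism1965, proof of Thm. 3.13] -/
theorem mem_region_chartMap_iff (hk : D.k = D'.k) {ε γ ℓl ℓu : ℝ} {x : M} (hxs : x ∈ D.chart.source)
    (hx : ‖D.coord x‖ ≤ R) :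
    D.chartMap D' x ∈ D'.region ε γ (ℓl + (f' p' - f p)) (ℓu + (f' p' - f p)) ↔
      x ∈ D.region ε γ ℓl ℓu := by
  obtain ⟨hs, hc⟩ := D.chartMap_mem_source_and_coord D' hR' hx
  have hf := D.apply_chartMap D' hR' hk hxs hx
  simp only [region, mem_setOf_eq, hc, hf, ← hk, mem_Icc, add_le_add_iff_right]
  tauto

/-- The chart map carries the core to the core (same core radius). [folklore] -/
theorem mem_core_chartMap_iff (hr : D.r = D'.r) {x : M} (hxs : x ∈ D.chart.source) (hx : ‖D.coord x‖ ≤ R) :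
    D.chartMap D' x ∈ D'.core ↔ x ∈ D.core := by
  obtain ⟨hs, hc⟩ := D.chartMap_mem_source_and_coord D' hR' hx
  simp only [core, mem_setOf_eq, hc, ← hr]
  tauto

/-! ### Smoothness -/

omit hR' in
/-- An open ball inside the target of an extended chart lies in the interior of the range of the
model, so the inverse extended chart is smooth there (not only within the range).
[folklore] -/
theorem contMDiffAt_extend_symm [IsManifold J ∞ M'] (hR' : closedBall (D'.chart.extend J p') R ⊆ (D'.chart.extend J).target)
    {y : 𝔼 m} (hy : y ∈ ball (D'.chart.extend J p') R) :
    ContMDiffAt 𝓘(ℝ, 𝔼 m) J ∞ (D'.chart.extend J).symm y := by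
  have hsub : ball (D'.chart.extend J p') R ⊆ (D'.chart.extend J).target :=
    ball_subset_closedBall.trans hR'
  have h := contMDiffOn_extend_symm (I := J) D'.mem_maximalAtlas
  rw [← D'.chart.extend_target' (I := J)] at h
  exact (h y (hsub hy)).contMDiffAt (mem_of_superset (isOpen_ball.mem_nhds hy) hsub)

/-- **The chart map is smooth on the open chart ball.** [folklore] -/
theorem contMDiffOn_chartMap [IsManifold J ∞ M'] : ContMDiffOn J J ∞ (D.chartMap D') (D.cball R) := by
  intro x hx
  have h1 : ContMDiffAt J 𝓘(ℝ, 𝔼 m) ∞ (fun q => D'.chart.extend J p' + D.coord q) x :=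
    contMDiffAt_const.add (((D.chart.contMDiffAt_extend D.mem_maximalAtlas hx.1).sub contMDiffAt_const))
  have hy : D'.chart.extend J p' + D.coord x ∈ ball (D'.chart.extend J p') R := by
    rw [mem_ball, dist_eq_norm, add_sub_cancel_left]; exact hx.2
  exact ((D'.contMDiffAt_extend_symm hR' hy).comp x h1).contMDiffWithinAt

/-! ### The chart map intertwines the fields -/

/-- **The chart map intertwines the fields**: `d(chartMap)(X x) = X' (chartMap x)` on the open
chart ball (both fields are `Ê_{k,r}` in coordinates; same index, same core radius).
[cite: MilnorHCobordism1965, Def. 3.1 and proof of Thm. 3.13] -/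
theorem mfderiv_chartMap_apply [IsManifold J ∞ M] [IsManifold J ∞ M'] (hk : D.k = D'.k) (hr : D.r = D'.r)
    {x : M} (hx : x ∈ D.cball R) :
    mfderiv J J (D.chartMap D') x (X x) = X' (D.chartMap D' x) := by
  set Φ := D.chart.extend J with hΦ
  set Φ' := D'.chart.extend J with hΦ'
  set c : 𝔼 m := Φ p with hc
  set c' : 𝔼 m := Φ' p' with hc'
  set u : 𝔼 m := D.coord x with hu
  set y : M' := D.chartMap D' x with hy
  obtain ⟨hys, hyc⟩ := D.chartMap_mem_source_and_coord D' hR' hx.2.le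
  have hcu : c' + u ∈ ball c' R := by rw [mem_ball, dist_eq_norm, add_sub_cancel_left]; exact hx.2
  have hcu_t : c' + u ∈ Φ'.target := (ball_subset_closedBall.trans hR') hcu
  have hΦ'y : Φ' y = c' + u := by rw [hy, chartMap]; exact Φ'.right_inv hcu_t
  -- derivative of the affine map `T q = c' + coord q`
  have hΦx : HasMFDerivAt J 𝓘(ℝ, 𝔼 m) Φ x (mfderiv J 𝓘(ℝ, 𝔼 m) Φ x) :=
    (mdifferentiableAt_extend_of_mem_maximalAtlas D.mem_maximalAtlas hx.1).hasMFDerivAt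
  have hg : HasMFDerivAt 𝓘(ℝ, 𝔼 m) 𝓘(ℝ, 𝔼 m) (fun v : 𝔼 m => c' + (v - c)) (Φ x)
      (ContinuousLinearMap.id ℝ (𝔼 m)) := by
    rw [hasMFDerivAt_iff_hasFDerivAt]
    exact ((hasFDerivAt_id _).sub_const c).const_add c'
  have hT : HasMFDerivAt J 𝓘(ℝ, 𝔼 m) (fun q => c' + D.coord q) x (mfderiv J 𝓘(ℝ, 𝔼 m) Φ x) :=
    (hg.comp x hΦx).congr_mfderiv (ContinuousLinearMap.id_comp _)
  -- derivative of `Φ'.symm` at `c' + u`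
  set L := mfderiv 𝓘(ℝ, 𝔼 m) J Φ'.symm (c' + u) with hL
  have hΦ's : HasMFDerivAt 𝓘(ℝ, 𝔼 m) J Φ'.symm (c' + u) L :=
    ((D'.contMDiffAt_extend_symm hR' hcu).mdifferentiableAt (by simp)).hasMFDerivAt
  have hchain : HasMFDerivAt J J (D.chartMap D') x (L.comp (mfderiv J 𝓘(ℝ, 𝔼 m) Φ x)) :=
    hΦ's.comp x hT
  rw [hchain.mfderiv]
  change L (mfderiv J 𝓘(ℝ, 𝔼 m) (D.chart.extend J) x (X x)) = X' y
  rw [D.mfderiv_eq x hx.1]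
  -- the field `X'` at `y` in coordinates
  have hX'y : mfderiv J 𝓘(ℝ, 𝔼 m) Φ' y (X' y) = handleModelField D.k D.r_pos u := by
    have h1 := D'.mfderiv_eq y hys
    change mfderiv J 𝓘(ℝ, 𝔼 m) Φ' y (X' y) = handleModelField D'.k D'.r_pos (D'.coord y) at h1
    rw [h1, hyc, handleModelField_congr D'.r_pos D.r_pos hk.symm hr.symm]
  -- `L ∘ dΦ'_y = id`
  have hLid : L.comp (mfderiv J 𝓘(ℝ, 𝔼 m) Φ' y) = ContinuousLinearMap.id ℝ _ := by
    have h1 := mfderivWithin_extend_symm_comp_mfderiv_extend (I := J) D'.mem_maximalAtlas hcu_t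
    have hy' : Φ'.symm (c' + u) = y := rfl
    rw [hy'] at h1
    have hnhds : range J ∈ 𝓝 (c' + u) :=
      mem_of_superset (isOpen_ball.mem_nhds hcu)
        ((ball_subset_closedBall.trans hR').trans (D'.chart.extend_target_subset_range (I := J)))
    rw [mfderivWithin_of_mem_nhds hnhds] at h1
    exact h1
  have := congrArg (fun T : TangentSpace J y →L[ℝ] TangentSpace J y => T (X' y)) hLid
  change L (mfderiv J 𝓘(ℝ, 𝔼 m) Φ' y (X' y)) = X' y at this
  rw [hX'y] at this
  exact this

end HandleChart

/-! ### The chart map conjugates the flows -/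

section Flows

variable {f : M → ℝ} {X : Π x : M, TangentSpace J x} {θ : ℝ × M → M} {p : M}
  {f' : M' → ℝ} {X' : Π x : M', TangentSpace J x} {θ' : ℝ × M' → M'} {p' : M'}
  [IsManifold J ∞ M] [IsManifold J ∞ M'] [T2Space M']

/-- **The chart map conjugates the flows** as long as the orbit stays in the chart ball:
`chartMap (θ (t, z)) = θ' (t, chartMap z)` (naturality of flows for the chart-related fields,
`IsFlowOf.apply_eq_of_mfderiv_eq_of_Icc`). [cite: LeeSmoothManifolds2013, Prop. 9.13] -/
theorem IsFlowOf.chartMap_apply_eq (h : IsFlowOf J X θ) (h' : IsFlowOf J X' θ')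
    (hX' : ContMDiff J J.tangent 1 fun y => (⟨y, X' y⟩ : TangentBundle J M'))
    (D : HandleChart J f X p) (D' : HandleChart J f' X' p') {R : ℝ}
    (hR' : closedBall (D'.chart.extend J p') R ⊆ (D'.chart.extend J).target)
    (hk : D.k = D'.k) (hr : D.r = D'.r) {z : M} {T₁ T₂ : ℝ} (hT₁ : T₁ ≤ 0) (hT₂ : 0 ≤ T₂)
    (hmem : ∀ t ∈ Icc T₁ T₂, θ (t, z) ∈ D.cball R) {t : ℝ} (ht : t ∈ Icc T₁ T₂) :
    D.chartMap D' (θ (t, z)) = θ' (t, D.chartMap D' z) :=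
  h.apply_eq_of_mfderiv_eq_of_Icc h' hX' D.isOpen_cball
    ((D.contMDiffOn_chartMap D' hR').of_le (by exact_mod_cast le_top))
    (fun x hx => D.mfderiv_chartMap_apply D' hR' hk hr hx) hT₁ hT₂ hmem ht

end Flows

end Literature.Topology.FourManifolds
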